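import Summits.AnomalousDissipation.AnomalousDissipation.Theorems.SawtoothPulseCascadeK1LocalisedCascadeFejerKernel
import Summits.AnomalousDissipation.AnomalousDissipation.Theorems.SawtoothPulseCascadeK1LocalisedCascadeTrapezoidKernel

/-!
# K1loc, line `Spectral` / thin start — helper: THE TRAPEZOID KERNEL THROUGH FEJÉR KERNELS (`L¹ ≤ (L₁+L₂)/D`, tail `≤ π/(Dδ)`)

Helper file of the prover lane on the crux `K1LocalisedCascade` (stmt-AnomalousDissipation-19491), route
`SawtoothPulseCascade` (S-D fibre ledger; constants lever of memo v9 §9, file (a)).  The trapezoid symbol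
`χ(m) = min(1, max(0, (L₂ − |m|)/D))`, `D = L₂ − L₁`, equals `((L₂ − |m|)⁺ − (L₁ − |m|)⁺)/D`, so its kernel is a difference of
Fejér kernels: `k_χ(s) = (‖S_{L₂}(s)‖² − ‖S_{L₁}(s)‖²)/D`, `S_n(s) = Σ_{m<n} e_{−m}(s)` (`…FejerKernel.fejer_identity`).  Hence
* `integral_norm_trapezoidKernel_le_ratio` — `∫_T |k_χ| ≤ (L₁ + L₂)/D` (unit mass of the Fejér kernels): `≤ 3` for a ramp as wide as
  the plateau, `→ 1` for wide ramps — versus the `√(L₂/D)` of the Cauchy–Schwarz bound;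
* `norm_trapezoidKernel_le_inv_sq` — `|k_χ(s)| ≤ 1/(2D‖s‖²)`;
* `setIntegral_norm_trapezoidKernel_le` — `∫_{‖s‖ ≥ δ} |k_χ| ≤ π/(Dδ)`: the tail is paid by the FIRST moment of the kernel.
No definitions; no statement about the crux. [cite: Grafakos2014, §3.1.3 (Fejér and de la Vallée-Poussin kernels)] [problem: turb]
-/

-- `Summit.<Summit>.<Problem>`: single-conjunct summit, the duplicate namespace segment is deliberate.
set_option linter.dupNamespace false

noncomputable section

namespace Summit.AnomalousDissipation.AnomalousDissipation.Theorems.SawtoothPulseCascade.K1Window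

open MeasureTheory Set Filter Topology Function Complex
open scoped Real

section Trapezoid

variable {χ : ℤ → ℂ} {L₁ L₂ : ℕ}

/-- The trapezoid symbol as a difference of two triangles: `χ(m) = ((L₂ − |m|)⁺ − (L₁ − |m|)⁺)/D`. [folklore] -/
theorem trapezoid_eq_sub_triangles (hL : L₁ < L₂)
    (hχ : ∀ m : ℤ, χ m = ((min 1 (max 0 (((L₂ : ℝ) - |(m : ℝ)|) / ((L₂ : ℝ) - L₁))) : ℝ) : ℂ)) (m : ℤ) :
    χ m = (((max 0 ((L₂ : ℝ) - |(m : ℝ)|) - max 0 ((L₁ : ℝ) - |(m : ℝ)|)) / ((L₂ : ℝ) - L₁) : ℝ) : ℂ) := by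
  have hD : (0 : ℝ) < (L₂ : ℝ) - L₁ := by
    have : (L₁ : ℝ) < L₂ := by exact_mod_cast hL
    linarith
  rw [hχ]
  congr 1
  by_cases h1 : |(m : ℝ)| ≤ L₁
  · have e1 : max 0 ((L₂ : ℝ) - |(m : ℝ)|) = L₂ - |(m : ℝ)| := max_eq_right (by linarith [hD])
    have e2 : max 0 ((L₁ : ℝ) - |(m : ℝ)|) = L₁ - |(m : ℝ)| := max_eq_right (by linarith)
    have e3 : 1 ≤ ((L₂ : ℝ) - |(m : ℝ)|) / ((L₂ : ℝ) - L₁) := by rw [le_div_iff₀ hD]; linarith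
    rw [e1, e2, max_eq_right (zero_le_one.trans e3), min_eq_left e3]
    field_simp; ring
  · push Not at h1
    have e2 : max 0 ((L₁ : ℝ) - |(m : ℝ)|) = 0 := max_eq_left (by linarith)
    rw [e2, sub_zero]
    by_cases h2 : |(m : ℝ)| ≤ L₂
    · have e1 : max 0 ((L₂ : ℝ) - |(m : ℝ)|) = L₂ - |(m : ℝ)| := max_eq_right (by linarith)
      have e3 : ((L₂ : ℝ) - |(m : ℝ)|) / ((L₂ : ℝ) - L₁) ≤ 1 := by rw [div_le_iff₀ hD]; linarith
      have e4 : 0 ≤ ((L₂ : ℝ) - |(m : ℝ)|) / ((L₂ : ℝ) - L₁) := div_nonneg (by linarith) hD.le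
      rw [e1, max_eq_right e4, min_eq_right e3]
    · push Not at h2
      have e1 : max 0 ((L₂ : ℝ) - |(m : ℝ)|) = 0 := max_eq_left (by linarith)
      have e4 : ((L₂ : ℝ) - |(m : ℝ)|) / ((L₂ : ℝ) - L₁) ≤ 0 := div_nonpos_of_nonpos_of_nonneg (by linarith) hD.le
      rw [e1, max_eq_left e4, min_eq_right zero_le_one, zero_div]

/-- The triangle sum over a symmetric range is the Fejér sum: `Σ_{l∈[-L,L]} (n − |l|)⁺ e_l = ‖S_n‖²` for `n ≤ L`. [cite: Grafakos2014, §3.1.3] -/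
theorem sum_triangle_eq_fejer {n L : ℕ} (hn : n ≤ L) (s : UnitAddCircle) :
    ∑ l ∈ Finset.Icc (-(L : ℤ)) L, ((max 0 ((n : ℝ) - |(l : ℝ)|) : ℝ) : ℂ) * fourier l s =
      ((‖∑ m ∈ Finset.range n, (fourier (-(m : ℤ)) s : ℂ)‖ ^ 2 : ℝ) : ℂ) := by
  rw [← fejer_identity n s]
  have hsub : Finset.Icc (-(n : ℤ)) n ⊆ Finset.Icc (-(L : ℤ)) L := Finset.Icc_subset_Icc (by omega) (by omega)
  rw [← Finset.sum_subset hsub (fun l hl hl' => ?_)]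
  · refine Finset.sum_congr rfl fun l hl => ?_
    rw [Finset.mem_Icc] at hl
    have : |(l : ℝ)| ≤ n := by
      rw [← Int.cast_abs]; exact_mod_cast (abs_le.mpr ⟨hl.1, hl.2⟩)
    rw [max_eq_right (by linarith)]; push_cast; ring
  · rw [Finset.mem_Icc] at hl hl'
    have : (n : ℝ) < |(l : ℝ)| := by
      rw [← Int.cast_abs]
      have : (n : ℤ) < |l| := by rw [lt_abs]; omega
      exact_mod_cast this
    rw [max_eq_left (by linarith)]; simp

/-- **The trapezoid kernel is a difference of Fejér kernels**: `Σ_{m∈[-L₂,L₂]} χ(m) e_{−m}(s) = (‖S_{L₂}(s)‖² − ‖S_{L₁}(s)‖²)/D`.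
[cite: Grafakos2014, §3.1.3] -/
theorem trapezoidKernel_eq (hL : L₁ < L₂)
    (hχ : ∀ m : ℤ, χ m = ((min 1 (max 0 (((L₂ : ℝ) - |(m : ℝ)|) / ((L₂ : ℝ) - L₁))) : ℝ) : ℂ)) (s : UnitAddCircle) :
    ∑ m ∈ Finset.Icc (-(L₂ : ℤ)) L₂, χ m * fourier (-m) s =
      (((‖∑ m ∈ Finset.range L₂, (fourier (-(m : ℤ)) s : ℂ)‖ ^ 2 - ‖∑ m ∈ Finset.range L₁, (fourier (-(m : ℤ)) s : ℂ)‖ ^ 2) /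
        ((L₂ : ℝ) - L₁) : ℝ) : ℂ) := by
  have hD : (0 : ℝ) < (L₂ : ℝ) - L₁ := by
    have : (L₁ : ℝ) < L₂ := by exact_mod_cast hL
    linarith
  -- reflect `m ↦ −m` (the symbol is even, the range symmetric)
  have hrefl : ∑ m ∈ Finset.Icc (-(L₂ : ℤ)) L₂, χ m * fourier (-m) s = ∑ l ∈ Finset.Icc (-(L₂ : ℤ)) L₂, χ l * fourier l s := by
    refine Finset.sum_nbij' (fun m => -m) (fun l => -l) (fun m hm => ?_) (fun l hl => ?_) (fun m _ => neg_neg m)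
      (fun l _ => neg_neg l) (fun m _ => ?_)
    · rw [Finset.mem_Icc] at hm ⊢; omega
    · rw [Finset.mem_Icc] at hl ⊢; omega
    · rw [hχ, hχ]; push_cast; rw [abs_neg]
  rw [hrefl]
  simp_rw [trapezoid_eq_sub_triangles hL hχ]
  have hsplit : ∀ l : ℤ, (((max 0 ((L₂ : ℝ) - |(l : ℝ)|) - max 0 ((L₁ : ℝ) - |(l : ℝ)|)) / ((L₂ : ℝ) - L₁) : ℝ) : ℂ) * fourier l s =
      (1 / ((L₂ : ℝ) - L₁) : ℂ) * ((((max 0 ((L₂ : ℝ) - |(l : ℝ)|)) : ℝ) : ℂ) * fourier l s -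
        (((max 0 ((L₁ : ℝ) - |(l : ℝ)|)) : ℝ) : ℂ) * fourier l s) := by
    intro l; push_cast; field_simp
  simp_rw [hsplit]
  rw [← Finset.mul_sum, Finset.sum_sub_distrib, sum_triangle_eq_fejer le_rfl s, sum_triangle_eq_fejer hL.le s]
  push_cast
  field_simp

/-- **`L¹` norm via Fejér**: `∫_T |k_χ| ≤ (L₁ + L₂)/D`. [cite: Grafakos2014, §3.1.3] -/
theorem integral_norm_trapezoidKernel_le_ratio (hL : L₁ < L₂)
    (hχ : ∀ m : ℤ, χ m = ((min 1 (max 0 (((L₂ : ℝ) - |(m : ℝ)|) / ((L₂ : ℝ) - L₁))) : ℝ) : ℂ)) :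
    ∫ s : UnitAddCircle, ‖∑ m ∈ Finset.Icc (-(L₂ : ℤ)) L₂, χ m * fourier (-m) s‖ ≤ ((L₁ : ℝ) + L₂) / ((L₂ : ℝ) - L₁) := by
  have hD : (0 : ℝ) < (L₂ : ℝ) - L₁ := by
    have : (L₁ : ℝ) < L₂ := by exact_mod_cast hL
    linarith
  have hI : ∀ {f : UnitAddCircle → ℝ}, Continuous f → Integrable f := fun hf =>
    hf.integrable_of_hasCompactSupport (HasCompactSupport.of_compactSpace _)
  simp_rw [trapezoidKernel_eq hL hχ, Complex.norm_real, Real.norm_eq_abs]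
  have hpt : ∀ s : UnitAddCircle,
      |(‖∑ m ∈ Finset.range L₂, (fourier (-(m : ℤ)) s : ℂ)‖ ^ 2 - ‖∑ m ∈ Finset.range L₁, (fourier (-(m : ℤ)) s : ℂ)‖ ^ 2) /
        ((L₂ : ℝ) - L₁)| ≤
      (1 / ((L₂ : ℝ) - L₁)) * (‖∑ m ∈ Finset.range L₂, (fourier (-(m : ℤ)) s : ℂ)‖ ^ 2 +
        ‖∑ m ∈ Finset.range L₁, (fourier (-(m : ℤ)) s : ℂ)‖ ^ 2) := by
    intro s
    rw [abs_div, abs_of_pos hD, div_eq_inv_mul, one_div]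
    refine mul_le_mul_of_nonneg_left ((abs_sub _ _).trans_eq ?_) (inv_nonneg.mpr hD.le)
    rw [abs_of_nonneg (sq_nonneg _), abs_of_nonneg (sq_nonneg _)]
  have hIl : Integrable (fun s : UnitAddCircle =>
      |(‖∑ m ∈ Finset.range L₂, (fourier (-(m : ℤ)) s : ℂ)‖ ^ 2 - ‖∑ m ∈ Finset.range L₁, (fourier (-(m : ℤ)) s : ℂ)‖ ^ 2) /
        ((L₂ : ℝ) - L₁)|) := hI (((continuous_fejer L₂).sub (continuous_fejer L₁)).div_const _ |>.abs)
  have hIr : Integrable (fun s : UnitAddCircle => (1 / ((L₂ : ℝ) - L₁)) *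
      (‖∑ m ∈ Finset.range L₂, (fourier (-(m : ℤ)) s : ℂ)‖ ^ 2 + ‖∑ m ∈ Finset.range L₁, (fourier (-(m : ℤ)) s : ℂ)‖ ^ 2)) :=
    hI (continuous_const.mul ((continuous_fejer L₂).add (continuous_fejer L₁)))
  have hI2 : Integrable (fun s : UnitAddCircle => ‖∑ m ∈ Finset.range L₂, (fourier (-(m : ℤ)) s : ℂ)‖ ^ 2) := hI (continuous_fejer L₂)
  have hI1 : Integrable (fun s : UnitAddCircle => ‖∑ m ∈ Finset.range L₁, (fourier (-(m : ℤ)) s : ℂ)‖ ^ 2) := hI (continuous_fejer L₁)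
  refine (integral_mono hIl hIr hpt).trans ?_
  rw [integral_const_mul, integral_add hI2 hI1, integral_fejer, integral_fejer]
  rw [one_div, inv_mul_eq_div, add_comm]

/-- **Pointwise decay**: `|k_χ(s)| ≤ 1/(2D‖s‖²)` for `s ≠ 0`. [cite: Grafakos2014, §3.1.3] -/
theorem norm_trapezoidKernel_le_inv_sq (hL : L₁ < L₂)
    (hχ : ∀ m : ℤ, χ m = ((min 1 (max 0 (((L₂ : ℝ) - |(m : ℝ)|) / ((L₂ : ℝ) - L₁))) : ℝ) : ℂ)) {s : UnitAddCircle}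
    (hs : 0 < ‖s‖) :
    ‖∑ m ∈ Finset.Icc (-(L₂ : ℤ)) L₂, χ m * fourier (-m) s‖ ≤ 1 / (2 * ((L₂ : ℝ) - L₁) * ‖s‖ ^ 2) := by
  have hD : (0 : ℝ) < (L₂ : ℝ) - L₁ := by
    have : (L₁ : ℝ) < L₂ := by exact_mod_cast hL
    linarith
  rw [trapezoidKernel_eq hL hχ, Complex.norm_real, Real.norm_eq_abs, abs_div, abs_of_pos hD]
  have h2 := fejer_le_inv_sq L₂ hs
  have h1 := fejer_le_inv_sq L₁ hs
  rw [div_le_iff₀ hD]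
  refine (abs_sub _ _).trans ?_
  rw [abs_of_nonneg (sq_nonneg _), abs_of_nonneg (sq_nonneg _)]
  have : 1 / (2 * ((L₂ : ℝ) - L₁) * ‖s‖ ^ 2) * ((L₂ : ℝ) - L₁) = 2 * (1 / (4 * ‖s‖ ^ 2)) := by field_simp; ring
  rw [this]; linarith

/-- **Tail of the trapezoid kernel**: `∫_{‖s‖ ≥ δ} |k_χ| ≤ π/(Dδ)` for `δ > 0` (pointwise decay + `∫(1+Λ²‖s‖²)⁻¹ ≤ π/Λ`).
[cite: Grafakos2014, §3.1.3] -/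
theorem setIntegral_norm_trapezoidKernel_le (hL : L₁ < L₂)
    (hχ : ∀ m : ℤ, χ m = ((min 1 (max 0 (((L₂ : ℝ) - |(m : ℝ)|) / ((L₂ : ℝ) - L₁))) : ℝ) : ℂ)) {δ : ℝ} (hδ : 0 < δ)
    {E : Set UnitAddCircle} (hEm : MeasurableSet E) (hE : ∀ s ∈ E, δ ≤ ‖s‖) :
    ∫ s in E, ‖∑ m ∈ Finset.Icc (-(L₂ : ℤ)) L₂, χ m * fourier (-m) s‖ ≤ π / (((L₂ : ℝ) - L₁) * δ) := by
  have hD : (0 : ℝ) < (L₂ : ℝ) - L₁ := by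
    have : (L₁ : ℝ) < L₂ := by exact_mod_cast hL
    linarith
  have hI : ∀ {f : UnitAddCircle → ℝ}, Continuous f → Integrable f := fun hf =>
    hf.integrable_of_hasCompactSupport (HasCompactSupport.of_compactSpace _)
  have hkc : Continuous fun s : UnitAddCircle => ‖∑ m ∈ Finset.Icc (-(L₂ : ℤ)) L₂, χ m * fourier (-m) s‖ :=
    continuous_norm.comp (continuous_finsetSum _ fun m _ => continuous_const.mul (fourier (-m)).continuous)
  set g : UnitAddCircle → ℝ := fun s => 1 / (((L₂ : ℝ) - L₁) * δ ^ 2) * (1 + (1 / δ) ^ 2 * ‖s‖ ^ 2)⁻¹ with hg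
  have hwc : Continuous fun s : UnitAddCircle => 1 + (1 / δ) ^ 2 * ‖s‖ ^ 2 :=
    continuous_const.add (continuous_const.mul (continuous_norm.pow 2))
  have hgc : Continuous g := by
    refine continuous_const.mul (hwc.inv₀ fun s => ?_)
    have : 0 ≤ (1 / δ) ^ 2 * ‖s‖ ^ 2 := by positivity
    linarith
  -- on `E`: `|k(s)| ≤ 1/(2D‖s‖²) ≤ 1/(D(‖s‖² + δ²)) = g(s)`
  have hpt : ∀ s ∈ E, ‖∑ m ∈ Finset.Icc (-(L₂ : ℤ)) L₂, χ m * fourier (-m) s‖ ≤ g s := by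
    intro s hs
    have hsδ := hE s hs
    have hs0 : 0 < ‖s‖ := hδ.trans_le hsδ
    refine (norm_trapezoidKernel_le_inv_sq hL hχ hs0).trans ?_
    have e : g s = 1 / (((L₂ : ℝ) - L₁) * (δ ^ 2 + ‖s‖ ^ 2)) := by
      simp only [hg]; field_simp
    rw [e, div_le_div_iff₀ (by positivity) (by positivity)]
    nlinarith [sq_nonneg δ, mul_pos hD hδ, mul_pos hD (sq_pos_of_pos hδ), hsδ, sq_nonneg (‖s‖ - δ)]
  calc ∫ s in E, ‖∑ m ∈ Finset.Icc (-(L₂ : ℤ)) L₂, χ m * fourier (-m) s‖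
      ≤ ∫ s in E, g s := setIntegral_mono_on (hI hkc).integrableOn (hI hgc).integrableOn hEm hpt
    _ ≤ ∫ s, g s := setIntegral_le_integral (hI hgc) (Eventually.of_forall fun s => by rw [hg]; positivity)
    _ ≤ 1 / (((L₂ : ℝ) - L₁) * δ ^ 2) * (π / (1 / δ)) := by
        rw [hg, integral_const_mul]
        exact mul_le_mul_of_nonneg_left (integral_inv_one_add_sq_norm_le (by positivity)) (by positivity)
    _ = π / (((L₂ : ℝ) - L₁) * δ) := by field_simp

end Trapezoid

end Summit.AnomalousDissipation.AnomalousDissipation.Theorems.SawtoothPulseCascade.K1Window
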